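import Mathlib
import Summits.ResolutionOfSingularities.ResolutionOfSingularities.Theorems.RadicialJungCleanModelsCleanLU3CompositeDownstairsDom
import Summits.ResolutionOfSingularities.ResolutionOfSingularities.Theorems.RadicialJungCleanModelsCleanLU3CompositeLiftMain
import Summits.ResolutionOfSingularities.ResolutionOfSingularities.Theorems.RadicialJungCleanModelsCleanLU3CompositeSlice
import Summits.ResolutionOfSingularities.ResolutionOfSingularities.Theorems.RadicialJungCleanModelsCleanLU3CompositeResidueFrame
import Summits.ResolutionOfSingularities.ResolutionOfSingularities.Theorems.RadicialJungCleanModelsCleanLU3CompositeFrame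
import Summits.ResolutionOfSingularities.ResolutionOfSingularities.Theorems.RadicialJungCleanModelsCleanLU3CompositeInert
import Summits.ResolutionOfSingularities.ResolutionOfSingularities.Theorems.RadicialJungCleanModelsCleanLU3CompositeBestApprox
import Summits.ResolutionOfSingularities.ResolutionOfSingularities.Theorems.RadicialJungCleanModelsCleanLU3CompositeLineRep
import Summits.ResolutionOfSingularities.ResolutionOfSingularities.Theorems.RadicialJungCleanModelsCleanLU3CdivSmall
import Summits.ResolutionOfSingularities.ResolutionOfSingularities.Theorems.RadicialJungCleanModelsLens5AbsDerivation
import HarnessLib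

/-!
# Route `RadicialJung`, crux `CleanModels` (stmt-15917), stub `stub_cleanLU3DefectNonDiscrete`, sub-line (C-div): the UPSTAIRS
# ASSEMBLY — clean local uniformization at a zero-dimensional valuation with a divisorial coarsening of height-one centre, modulo embedded
# resolution of surfaces (`hEmb`, F-32) and the two delegable stubs of the workfile (`hLU2` = `stub_cleanLU2`, `hpersist` = `stub_persistStep`)

Line `Sketch` rev 24 of crux stmt-ResolutionOfSingularities-15917; lead `res-B-lead-1` g4 (workfile `Lines/Sketch_Cdiv_assembly.lean` v2.1,
target `cleanLU3Defect_of_heightOneCoarsening`; memo `Lines/Sketch-memo-Cdiv-lift.md`).  OURS; nothing here proves resolution in characteristic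
`p`.  `cleanLU3Defect_of_heightOneCoarsening_of`: the hypotheses of `stub_cleanLU3DefectNonDiscrete` that are used (`A ⊆ O` finitely generated,
`Frac A = K`, `locAtCentre A O` regular of dimension `3`, every centre above `A` closed, `g₀` no `p`-th power, `g₀` without best `p`-th-power
approximation for `v`), PLUS a coarsening `O ≤ O₁ ≠ ⊤` with `locAtCentre (locAtCentre A O) O₁ = O₁` (the divisorial coarsening whose centre on the
model has height one), PLUS `hEmb`, `hLU2`, `hpersist` ⟹ the conclusion of the stub.  Chain: ✓ frame (`exists_frame_of_coarsening`) → ✓ D-abs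
(`absDerivation_of_forall_pow_ne'`) transported to `O₁` → ✓ best `v₁`-approximation (`exists_best_pthPowerApprox_of_derivation`) → ✓ dichotomy;
ramified contradicts `hdefect` (`isMin_of_ramified_coarse`) → ✓ GLUE 1 (`exists_bestApprox_data_in_frame`) → ✓ residue frame (`residueFrame`) →
✓ downstairs assembly (`exists_cleanMono_stage`, from `hLU2`, `hpersist`, ✓ MONO) → ✓ SLICE (`slice`) → ✓ LIFT (`lift_clean`) → ✓ change of
generator (`lineRep_change_of_generator`).
-/

noncomputable section

set_option linter.dupNamespace false -- mandated namespace of this single-conjunct summit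

open IsLocalRing AlgebraicGeometry CategoryTheory
open Literature.AlgebraicGeometry.Resolution

namespace Summit.ResolutionOfSingularities.ResolutionOfSingularities.Theorems.RadicialJung.CleanModels

/-- **(C-div), height-one case, modulo `hEmb`, `stub_cleanLU2`, `stub_persistStep`.**  See the module docstring. [folklore] -/
theorem cleanLU3Defect_of_heightOneCoarsening_of
    (hEmb : ∀ (Z : Scheme.{0}) [IsIntegral Z] [IsNoetherian Z], Scheme.IsRegular Z →
      Scheme.IsExcellent Z → ∀ (X : Set Z), IsClosed X → X ≠ Set.univ → topologicalKrullDim X ≤ 2 →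
        ∃ (Z' : Scheme.{0}) (π : Z' ⟶ Z), IsProper π ∧ Function.Surjective π.base ∧
          (∃ U : Z.Opens, (U : Set Z) = Xᶜ ∧ IsIso (π ∣_ U)) ∧
          IsStrictNormalCrossingsDivisor Z' (π.base ⁻¹' X))
    (p : ℕ) (hp : p.Prime) (k : Type) [Field k] [CharP k p]
    (hLU2 : ∀ (κ : Type) [Field κ] [Algebra k κ]
      (Ō : ValuationSubring κ) (Ā : Subalgebra k κ), Ā.toSubring ≤ Ō.toSubring → Ā.FG → IsFractionRing Ā κ →
      IsRegularLocalRing (locAtCentre Ā.toSubring Ō) →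
      ringKrullDim (locAtCentre Ā.toSubring Ō) = 2 →
      (∀ (T : Subring κ) (hT : T ≤ Ō.toSubring), Ā.toSubring ≤ T → (subringCentre T Ō hT).IsMaximal) →
      ∀ ū : κ, (∀ c : κ, c ^ p ≠ ū) →
      ∃ (Ā' : Subalgebra k κ), Ā'.toSubring ≤ Ō.toSubring ∧ Ā ≤ Ā' ∧ Ā'.FG ∧
      ∃ (_ : IsRegularLocalRing (locAtCentre Ā'.toSubring Ō)) (c : Fin p → κ), (∃ j : Fin p, (j : ℕ) ≠ 0 ∧ c j ≠ 0) ∧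
      ((∃ (d m : ℕ) (hmd : m ≤ d) (t : Fin d → ↥(locAtCentre Ā'.toSubring Ō)) (a : Fin m → ℕ) (u : ↥(locAtCentre Ā'.toSubring Ō)), IsUnit u ∧
      Ideal.span (Set.range t) = IsLocalRing.maximalIdeal ↥(locAtCentre Ā'.toSubring Ō) ∧
      ringKrullDim ↥(locAtCentre Ā'.toSubring Ō) = (d : WithBot ℕ∞) ∧ 0 < m ∧ (∀ i, ¬ p ∣ a i) ∧
      (∑ j : Fin p, c j ^ p * ū ^ (j : ℕ)) = (u : κ) * ∏ i : Fin m, ((t (Fin.castLE hmd i) : ↥(locAtCentre Ā'.toSubring Ō)) : κ) ^ (a i)) ∨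
      (∃ u : ↥(locAtCentre Ā'.toSubring Ō), IsUnit u ∧ (∑ j : Fin p, c j ^ p * ū ^ (j : ℕ)) = (u : κ) ∧
      ∀ c' : ↥(locAtCentre Ā'.toSubring Ō), u - c' ^ p ∉ IsLocalRing.maximalIdeal ↥(locAtCentre Ā'.toSubring Ō)) ∨
      (∃ s c' : ↥(locAtCentre Ā'.toSubring Ō), (∑ j : Fin p, c j ^ p * ū ^ (j : ℕ)) = (s : κ) ∧
      s - c' ^ p ∈ IsLocalRing.maximalIdeal ↥(locAtCentre Ā'.toSubring Ō) ∧
      s - c' ^ p ∉ IsLocalRing.maximalIdeal ↥(locAtCentre Ā'.toSubring Ō) ^ 2)))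
    (hpersist : ∀ (κ : Type) [Field κ] [CharP κ p]
      (Ō : ValuationSubring κ) (S S' : Subring κ) [IsRegularLocalRing S] [IsRegularLocalRing S'],
      ringKrullDim S = 2 → ringKrullDim S' = 2 → IsLocalRingOf S → IsQuadraticTransformAlong Ō S S' →
      SubringDominates S Ō.toSubring →
      ∀ (ū d : κ), d ∈ S → d ≠ 0 →
      ∀ (c : Fin p → κ), (∃ j : Fin p, (j : ℕ) ≠ 0 ∧ c j ≠ 0) →
      ∀ (x y : S), maximalIdeal S = Ideal.span {x, y} →
      ∀ (α β : ℕ), (∀ j : Fin p, c j * d * (x : κ) ^ α * (y : κ) ^ β ∈ S) →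
      ((∃ (a b : ℕ) (ε : S), IsUnit ε ∧ (a ≠ 0 ∨ b ≠ 0) ∧ (a = 0 ∨ ¬ p ∣ a) ∧ (b = 0 ∨ ¬ p ∣ b) ∧
          (∑ j : Fin p, c j ^ p * ū ^ (j : ℕ)) = (ε : κ) * (x : κ) ^ a * (y : κ) ^ b) ∨
        (∃ u : S, IsUnit u ∧ (∑ j : Fin p, c j ^ p * ū ^ (j : ℕ)) = (u : κ) ∧ ∀ c' : S, u - c' ^ p ∉ maximalIdeal S) ∨
        (∃ s c' : S, (∑ j : Fin p, c j ^ p * ū ^ (j : ℕ)) = (s : κ) ∧ s - c' ^ p ∈ maximalIdeal S ∧ s - c' ^ p ∉ maximalIdeal S ^ 2)) →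
      ∃ (c' : Fin p → κ), (∃ j : Fin p, (j : ℕ) ≠ 0 ∧ c' j ≠ 0) ∧
      ∃ (x' y' : S'), maximalIdeal S' = Ideal.span {x', y'} ∧
      ∃ (α' β' : ℕ), (∀ j : Fin p, c' j * d * (x' : κ) ^ α' * (y' : κ) ^ β' ∈ S') ∧
      ((∃ (a b : ℕ) (ε : S'), IsUnit ε ∧ (a ≠ 0 ∨ b ≠ 0) ∧ (a = 0 ∨ ¬ p ∣ a) ∧ (b = 0 ∨ ¬ p ∣ b) ∧
          (∑ j : Fin p, c' j ^ p * ū ^ (j : ℕ)) = (ε : κ) * (x' : κ) ^ a * (y' : κ) ^ b) ∨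
        (∃ u : S', IsUnit u ∧ (∑ j : Fin p, c' j ^ p * ū ^ (j : ℕ)) = (u : κ) ∧ ∀ c'' : S', u - c'' ^ p ∉ maximalIdeal S') ∨
        (∃ s c'' : S', (∑ j : Fin p, c' j ^ p * ū ^ (j : ℕ)) = (s : κ) ∧ s - c'' ^ p ∈ maximalIdeal S' ∧ s - c'' ^ p ∉ maximalIdeal S' ^ 2)))
    (K : Type) [Field K] [Algebra k K]
    (O : ValuationSubring K) (A : Subalgebra k K) (hAO : A.toSubring ≤ O.toSubring) (hAfg : A.FG)
    (hfrac : IsFractionRing A K)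
    (hreg : IsRegularLocalRing (locAtCentre A.toSubring O))
    (hdim3 : ringKrullDim (locAtCentre A.toSubring O) = 3)
    (hzd : ∀ (T : Subring K) (hT : T ≤ O.toSubring), A.toSubring ≤ T → (subringCentre T O hT).IsMaximal)
    (g₀ : K) (hg₀ : ∀ c : K, c ^ p ≠ g₀)
    (hdefect : ∀ f₀ : K, ∃ f₁ : K, O.valuation (g₀ - f₁ ^ p) < O.valuation (g₀ - f₀ ^ p))
    (O₁ : ValuationSubring K) (hOO₁ : O ≤ O₁) (hO₁ : O₁ ≠ ⊤)
    (hloc : locAtCentre (locAtCentre A.toSubring O) O₁ = O₁.toSubring) :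
    ∃ (A' : Subalgebra k K), A'.toSubring ≤ O.toSubring ∧ A ≤ A' ∧ A'.FG ∧
    ∃ (_ : IsRegularLocalRing (locAtCentre A'.toSubring O)) (c : Fin p → K), (∃ j : Fin p, (j : ℕ) ≠ 0 ∧ c j ≠ 0) ∧
    ((∃ (d m : ℕ) (hmd : m ≤ d) (t : Fin d → ↥(locAtCentre A'.toSubring O)) (a : Fin m → ℕ) (u : ↥(locAtCentre A'.toSubring O)), IsUnit u ∧
    Ideal.span (Set.range t) = IsLocalRing.maximalIdeal ↥(locAtCentre A'.toSubring O) ∧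
    ringKrullDim ↥(locAtCentre A'.toSubring O) = (d : WithBot ℕ∞) ∧ 0 < m ∧ (∀ i, ¬ p ∣ a i) ∧
    (∑ j : Fin p, c j ^ p * g₀ ^ (j : ℕ)) = (u : K) * ∏ i : Fin m, ((t (Fin.castLE hmd i) : ↥(locAtCentre A'.toSubring O)) : K) ^ (a i)) ∨
    (∃ u : ↥(locAtCentre A'.toSubring O), IsUnit u ∧ (∑ j : Fin p, c j ^ p * g₀ ^ (j : ℕ)) = (u : K) ∧
    ∀ c' : ↥(locAtCentre A'.toSubring O), u - c' ^ p ∉ IsLocalRing.maximalIdeal ↥(locAtCentre A'.toSubring O)) ∨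
    (∃ s c' : ↥(locAtCentre A'.toSubring O), (∑ j : Fin p, c j ^ p * g₀ ^ (j : ℕ)) = (s : K) ∧
    s - c' ^ p ∈ IsLocalRing.maximalIdeal ↥(locAtCentre A'.toSubring O) ∧
    s - c' ^ p ∉ IsLocalRing.maximalIdeal ↥(locAtCentre A'.toSubring O) ^ 2)) := by
  classical
  haveI : Fact p.Prime := ⟨hp⟩
  haveI : CharP K p := charP_of_injective_algebraMap (algebraMap k K).injective p
  haveI : IsFractionRing A K := hfrac
  have hp0 : p ≠ 0 := hp.ne_zero
  set S : Subring K := locAtCentre A.toSubring O with hSdef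
  have hSO : S ≤ O.toSubring := locAtCentre_le hAO
  have hAS : A.toSubring ≤ S := le_locAtCentre A.toSubring O
  have hdimA : ringKrullDim A = 3 := by
    rw [← ringKrullDim_locAtCentre_eq_of_isMaximal A hAfg O hAO (hzd _ hAO le_rfl)]; exact hdim3
  -- an element of the model in the centre of `O₁` (as `O₁ ≠ K`)
  have hcentre : ∃ b : K, b ∈ A ∧ b ≠ 0 ∧ O₁.valuation b < 1 := by
    by_contra hnone
    push Not at hnone
    apply hO₁
    rw [eq_top_iff]
    intro x _
    obtain ⟨a, b, hb, rfl⟩ := IsFractionRing.div_surjective (A := A) x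
    have hb0 : (b : K) ≠ 0 := by
      intro h
      have : (b : A) = 0 := Subtype.ext h
      rw [this] at hb; exact zero_notMem_nonZeroDivisors hb
    have hvb : O₁.valuation (b : K) = 1 :=
      le_antisymm ((O₁.valuation_le_one_iff _).mpr (hOO₁ (hAO b.2))) (hnone _ b.2 hb0)
    change (a : K) / (b : K) ∈ O₁
    rw [← O₁.valuation_le_one_iff, map_div₀, hvb, div_one, O₁.valuation_le_one_iff]
    exact hOO₁ (hAO a.2)
  obtain ⟨t₀, ht₀A, ht₀0, hv₁t₀⟩ := hcentre
  -- THE FRAME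
  obtain ⟨A₁, hAA₁, hA₁fg, hA₁O, hreg₁, hdim₁, hSR₁, t, t₂, t₃, ht, ht₂, ht₃, hmax₁, hvt, hvt₂, hvt₃⟩ :=
    exists_frame_of_coarsening hEmb k O A hAO hAfg hfrac hreg hdim3 hzd O₁ hOO₁ hloc t₀ (hAS ht₀A) ht₀0 hv₁t₀
  set R₁ : Subring K := locAtCentre A₁.toSubring O with hR₁def
  haveI := hreg₁
  have hR₁O : R₁ ≤ O.toSubring := locAtCentre_le hA₁O
  have hR₁O₁ : R₁ ≤ O₁.toSubring := fun z hz => hOO₁ (hR₁O hz)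
  have hzd₁ : ∀ (T : Subring K) (hT : T ≤ O.toSubring), A₁.toSubring ≤ T → (subringCentre T O hT).IsMaximal :=
    fun T hT hA₁T => hzd T hT (fun z hz => hA₁T (hAA₁ hz))
  have hloc₁ : locAtCentre R₁ O₁ = O₁.toSubring :=
    le_antisymm (locAtCentre_le hR₁O₁) (by rw [← hloc]; exact locAtCentre_mono O₁ hSR₁)
  have hloc₁' : O₁.toSubring ≤ locAtCentre R₁ O₁ := hloc₁.symm.le
  have hfrac₁ : IsFractionRing A₁ K := isFractionRing_of_le hAA₁ hfrac
  have ht0 : t ≠ 0 := by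
    intro h; rw [h, map_zero] at hvt
    -- `0 < 1` is fine, but we need `t ≠ 0` for the uniformiser: `v₁ t₂ = 1` forces a nonzero centre element; use `t₀` instead? We know
    -- `t` is part of a regular system of parameters of a domain of dimension 3, hence nonzero:
    exact absurd hvt (by
      have htm : (⟨t, ht⟩ : R₁) ∈ ({⟨t, ht⟩, ⟨t₂, ht₂⟩, ⟨t₃, ht₃⟩} : Set R₁) := Or.inl rfl
      have : Prime (⟨t, ht⟩ : R₁) := prime_of_rsop_three R₁ hdim₁ _ _ _ hmax₁
      exact absurd (Subtype.ext h : (⟨t, ht⟩ : R₁) = 0) this.ne_zero)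
  have htprime : Prime (⟨t, ht⟩ : R₁) := prime_of_rsop_three R₁ hdim₁ _ _ _ hmax₁
  -- NORMALISE `g₀` into `A`: `g₁ := b^p g₀ ∈ A`
  obtain ⟨ga, gb, hgb, hg₀eq⟩ := IsFractionRing.div_surjective (A := A) g₀
  have hgb0 : (gb : K) ≠ 0 := by
    intro h
    have : (gb : A) = 0 := Subtype.ext h
    rw [this] at hgb; exact zero_notMem_nonZeroDivisors hgb
  have hg₀eq' : g₀ = (ga : K) / (gb : K) := hg₀eq.symm
  set g₁ : K := (gb : K) ^ p * g₀ with hg₁def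
  have hg₁A : g₁ ∈ A := by
    have : g₁ = (ga : K) * (gb : K) ^ (p - 1) := by
      rw [hg₁def, hg₀eq']
      have hp1 : (gb : K) ^ p = (gb : K) ^ (p - 1) * (gb : K) := by
        rw [← pow_succ, Nat.sub_add_cancel hp.one_lt.le]
      rw [hp1, mul_assoc, mul_div_assoc', mul_div_cancel_left₀ _ hgb0, mul_comm]
    rw [this]; exact A.mul_mem ga.2 (A.pow_mem gb.2 _)
  have hg₁R₁ : g₁ ∈ R₁ := hSR₁ (hAS hg₁A)
  have hg₁ : ∀ c : K, c ^ p ≠ g₁ := by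
    intro c hc
    apply hg₀ (c / gb)
    rw [div_pow, hc, hg₁def, mul_div_cancel_left₀ _ (pow_ne_zero _ hgb0)]
  have hdefect₁ : ∀ f₀ : K, ∃ f₁ : K, O.valuation (g₁ - f₁ ^ p) < O.valuation (g₁ - f₀ ^ p) := by
    intro f₀
    obtain ⟨f₁, hf₁⟩ := hdefect (f₀ / gb)
    refine ⟨gb * f₁, ?_⟩
    have e1 : g₁ - ((gb : K) * f₁) ^ p = (gb : K) ^ p * (g₀ - f₁ ^ p) := by rw [hg₁def]; ring
    have e2 : g₁ - f₀ ^ p = (gb : K) ^ p * (g₀ - (f₀ / gb) ^ p) := by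
      rw [hg₁def, div_pow, mul_sub, mul_div_cancel₀ _ (pow_ne_zero _ hgb0)]
    rw [e1, e2, map_mul, map_mul]
    exact mul_lt_mul_of_pos_left hf₁ (by rw [map_pow]; exact pow_pos (zero_lt_iff.mpr ((Valuation.ne_zero_iff _).mpr hgb0)) _)
  -- D-abs, transported to `O₁`
  obtain ⟨D, s, hs, hDA₁, hDg₁⟩ := Lens5.AbsDerivation.absDerivation_of_forall_pow_ne' p hp k K A₁ hA₁fg hfrac₁ g₁ hg₁
  have hDR₁ : ∀ y ∈ R₁, s * D y ∈ R₁ := mul_derivation_mem_locAtCentre D s hDA₁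
  have hDO₁ : ∀ y : K, y ∈ O₁ → s * D y ∈ O₁ := fun y hy => mul_derivation_mem_of_isLocalization D s hDR₁ hloc₁.symm y hy
  -- Step 0: a best `v₁`-approximation
  have hπ : ∀ x : K, O₁.valuation x < 1 → O₁.valuation x ≤ O₁.valuation t :=
    valuation_le_of_lt_one O₁ R₁ hR₁O₁ hloc₁' ⟨t, ht⟩ htprime hvt
  have harch : ∀ x : K, x ≠ 0 → ∃ n : ℕ, O₁.valuation t ^ n ≤ O₁.valuation x :=
    exists_pow_le_valuation O₁ R₁ hR₁O₁ hloc₁' ⟨t, ht⟩ htprime hvt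
  obtain ⟨a, hbest⟩ := exists_best_pthPowerApprox_of_derivation p hp O₁ t ht0 hvt hπ harch D s hs hDO₁ g₁ (hR₁O₁ hg₁R₁) hDg₁
  -- Step 1: dichotomy; the ramified branch contradicts `hdefect`
  have hne : g₁ - a ^ p ≠ 0 := fun h => hg₁ a (sub_eq_zero.mp h).symm
  rcases bestApprox_dichotomy p O₁ g₁ a hbest hne with hram | ⟨c, hc0, hvc, -, -, hres⟩
  · exfalso
    obtain ⟨f₁, hf₁⟩ := hdefect₁ a
    exact absurd (isMin_of_ramified_coarse p O O₁ hOO₁ g₁ a hram f₁) (not_le.mpr hf₁)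
  -- GLUE 1
  obtain ⟨w, a', uu, m, hvw, hvuu, hrel, hresuu⟩ :=
    exists_bestApprox_data_in_frame p O₁ R₁ hR₁O₁ hloc₁' ⟨t, ht⟩ htprime hvt g₁ hg₁R₁ a c hc0 hvc hbest hres
  have hw0 : (w : K) ≠ 0 := ne_zero_of_valuation_eq_one hvw
  -- `u := uu` and its expression in the `K^p`-line of `g₀`
  set αK : K := (w : K) * (gb : K) / t ^ m with hαK
  set βK : K := -((a' : K) / t ^ m) with hβK
  have hαK0 : αK ≠ 0 := div_ne_zero (mul_ne_zero hw0 hgb0) (pow_ne_zero _ ht0)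
  have hueq : (uu : K) = αK ^ p * g₀ + βK ^ p := by
    have h1 : (uu : K) = ((w : K) ^ p * g₁ - (a' : K) ^ p) / t ^ (p * m) := by
      rw [hrel, mul_div_cancel_left₀ _ (pow_ne_zero _ ht0)]
    rw [h1, hαK, hβK, hg₁def, neg_pow, neg_one_pow_char K p, div_pow, div_pow, mul_pow, mul_comm p m, pow_mul]
    field_simp
    ring
  -- THE RESIDUE FRAME
  have hkO₁ : ∀ c : k, algebraMap k K c ∈ O₁ := fun c => hOO₁ (hA₁O (A₁.algebraMap_mem c))
  letI : Algebra k (ResidueField O₁) :=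
    ((residue O₁).comp ((algebraMap k K).codRestrict O₁.toSubring hkO₁)).toAlgebra
  have hcompat : ∀ c : k, algebraMap k (ResidueField O₁) c = residue O₁ ⟨algebraMap k K c, hOO₁ (hA₁O (A₁.algebraMap_mem c))⟩ :=
    fun c => rfl
  haveI : CharP (ResidueField O₁) p := charP_of_injective_algebraMap (algebraMap k (ResidueField O₁)).injective p
  obtain ⟨Ā, hĀim, hĀfg, hĀŌ, hfracĀ, hzdb, hSb, hregb, hdimb, -⟩ :=
    residueFrame O O₁ hOO₁ A₁ hA₁O hA₁fg hreg₁ hdim₁ hzd₁ hloc₁ t t₂ t₃ ht ht₂ ht₃ hmax₁ hvt hcompat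
  set Ō := residueValuationSubring O O₁ hOO₁ with hŌdef
  haveI : IsFractionRing Ā (ResidueField O₁) := hfracĀ
  -- `ū` is not a `p`-th power in `κ₁`
  have huO₁ : (uu : K) ∈ O₁ := hR₁O₁ uu.2
  set ub : ResidueField O₁ := residue O₁ ⟨(uu : K), huO₁⟩ with hub
  have hub' : ∀ cb : ResidueField O₁, cb ^ p ≠ ub := by
    intro cb hcb
    obtain ⟨d, rfl⟩ := residue_surjective cb
    have : residue O₁ (⟨(uu : K), huO₁⟩ - d ^ p) = 0 := by rw [map_sub, map_pow, hcb, sub_self]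
    rw [residue_eq_zero_iff] at this
    have hlt := (O₁.valuation_lt_one_iff _).mp this
    exact hresuu d d.2 hlt
  -- THE DOWNSTAIRS ASSEMBLY
  obtain ⟨Rb, hRb0, hstepb, M, hRM, -, cb, hcb, xb, yb, hxb0, hyb0, hxy, Lb, hLb, hden, hclean⟩ :=
    exists_cleanMono_stage' hEmb p (hLU2 (ResidueField O₁)) (hpersist (ResidueField O₁)) Ō Ā hĀŌ hĀfg hregb hdimb hzdb ub hub'
  -- THE SLICE up to the stage `M`
  have h0 : ((locAtCentre A₁.toSubring O).comap O₁.toSubring.subtype).map (residue O₁) = Rb 0 := by rw [hRb0]; exact hSb.symm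
  have h0dom : SubringDominates (Rb 0) Ō.toSubring := by rw [hRb0]; exact subringDominates_locAtCentre hĀŌ
  obtain ⟨AM, hAMO, hAAM, hAMfg, hregM, hR₁RM, himm⟩ := slice O O₁ hOO₁ A A₁ hAA₁ hA₁fg hA₁O hreg₁ Rb h0 h0dom hstepb M
  -- THE LIFT
  haveI := hRM
  have hlocM : O₁.toSubring ≤ locAtCentre (locAtCentre AM.toSubring O) O₁ := hloc₁'.trans (locAtCentre_mono O₁ hR₁RM)
  have hcentreM : ∃ r ∈ locAtCentre AM.toSubring O, r ≠ 0 ∧ O₁.valuation r < 1 := ⟨t, hR₁RM ht, ht0, hvt⟩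
  have hSdom : SubringDominates (Rb M) Ō.toSubring := (sequence_dominates h0dom hstepb M).1
  obtain ⟨A', hA'O, hAA', hA'fg, hreg', c', hc', hforms⟩ :=
    lift_clean p O O₁ hOO₁ A hAfg hzd hdimA AM hAAM hAMfg hAMO hregM hlocM hcentreM (uu : K) (hR₁RM uu.2) (Rb M) hSdom himm
      cb hcb xb yb hxb0 hyb0 hxy Lb hLb hden hclean
  -- CHANGE OF GENERATOR back to `g₀`
  obtain ⟨c'', hsum, hnt⟩ := lineRep_change_of_generator p g₀ αK βK hαK0 c'
  have hsum' : (∑ j : Fin p, c' j ^ p * (uu : K) ^ (j : ℕ)) = ∑ j : Fin p, c'' j ^ p * g₀ ^ (j : ℕ) := by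
    rw [← hsum]
    refine Finset.sum_congr rfl fun j _ => ?_
    rw [hueq]
  refine ⟨A', hA'O, hAA', hA'fg, hreg', c'', hnt hc', ?_⟩
  rw [← hsum']
  exact hforms

end Summit.ResolutionOfSingularities.ResolutionOfSingularities.Theorems.RadicialJung.CleanModels

end
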